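import Mathlib
import HarnessLib
import Literature.Analysis.FluidPDE.KNSSSwirlSupNonpos
import Summits.NavierStokesRegularity.NavierStokesRegularity.Theorems.HalfSpaceWindowDoorCirculationCarryingRigiditySourcedSwirlEstimates

/-!
# Route `HalfSpaceWindowDoor`, crux `CirculationCarryingRigidity` (stmt-NavierStokesRegularity-25311) — the SOURCED SWIRL
# LIOUVILLE TOOL, part 4b: the estimate of the extra-drift term

The one NEW estimate of the sourced argument: for a sourced swirl triple (`…Defs.IsSourcedSwirl`) and KNSS's cut-off `φ_{L,T}`,
`|∫ β ∂ᵣf φ dy| ≤ (A/√(τ'−s)) · C_f C_S |{r ≤ 4, |z| ≤ 2(L+1)}|` (`estimate_IV`): `|β| ≤ A/√(τ'−s)`, `∂ᵣf ≥ 0`, `0 ≤ φ ≤ Ψ_L` with the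
radial plateau `Ψ_L(y) = ψ_{L+1}(y/2)` (`plateau_props`, `plateau_pointwise`: smooth, axisymmetric, compactly supported, `= 1` on the
support of `φ`, supported in `{r ≤ 4}`), `∂ᵣf Ψ ≤ 2(2/r)∂ᵣf Ψ` there, and the axis integration by parts
`∫(2/r)∂ᵣf Ψ = −∫(2/r) f ∂ᵣΨ` (tree `integrable_and_integral_two_div_cylRadius_mul_fderiv_eR`, `f = 0` on the axis) with
`(2/r)|∂ᵣΨ| ≤ C_S/2` on `{2 ≤ r ≤ 4, |z| ≤ 2(L+1)}`.

Seat ns-hsw-p1 g3 (LEAD of 25311, cell pub-ns-dss).  WHAT THIS IS NOT: not a statement about Navier–Stokes regularity; a linear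
parabolic Liouville tool (KNSS 2009 Thm 5.3 with an extra radial drift); helper `--supports` 25311.
-/

noncomputable section

-- the summit and its single sub-problem share the name (CONVENTIONS §1), as in every Theorems file
set_option linter.dupNamespace false

namespace Summit.NavierStokesRegularity.NavierStokesRegularity.Theorems.HalfSpaceWindowDoorCirculationCarryingRigiditySourcedSwirlSourceEstimate

open MeasureTheory Set Function Filter Topology TopologicalSpace InnerProductSpace WithLp Metric
open scoped Laplacian RealInnerProductSpace ContDiff
open Literature.Analysis Literature.Analysis.FluidPDE
open Summit.NavierStokesRegularity.NavierStokesRegularity.Theorems.HalfSpaceWindowDoorCirculationCarryingRigidityDefs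
open Summit.NavierStokesRegularity.NavierStokesRegularity.Theorems.HalfSpaceWindowDoorCirculationCarryingRigiditySourcedSwirl
open Summit.NavierStokesRegularity.NavierStokesRegularity.Theorems.HalfSpaceWindowDoorCirculationCarryingRigiditySourcedSwirlPlateau
open Summit.NavierStokesRegularity.NavierStokesRegularity.Theorems.HalfSpaceWindowDoorCirculationCarryingRigiditySourcedSwirlSpaceTime
open Summit.NavierStokesRegularity.NavierStokesRegularity.Theorems.HalfSpaceWindowDoorCirculationCarryingRigiditySourcedSwirlIdentity
open Summit.NavierStokesRegularity.NavierStokesRegularity.Theorems.HalfSpaceWindowDoorCirculationCarryingRigiditySourcedSwirlEstimates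
open Summit.NavierStokesRegularity.NavierStokesRegularity.Theorems.HalfSpaceWindowDoorCirculationCarryingRigiditySourcedSwirl.IsSourcedSwirl
open Summit.NavierStokesRegularity.NavierStokesRegularity.Theorems.HalfSpaceWindowDoorCirculationCarryingRigiditySourcedSwirlPlateau.IsSourcedSwirl
open Summit.NavierStokesRegularity.NavierStokesRegularity.Theorems.HalfSpaceWindowDoorCirculationCarryingRigiditySourcedSwirlSpaceTime.IsSourcedSwirl
open Summit.NavierStokesRegularity.NavierStokesRegularity.Theorems.HalfSpaceWindowDoorCirculationCarryingRigiditySourcedSwirlIdentity.IsSourcedSwirl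
open Summit.NavierStokesRegularity.NavierStokesRegularity.Theorems.HalfSpaceWindowDoorCirculationCarryingRigiditySourcedSwirlEstimates.IsSourcedSwirl

namespace IsSourcedSwirl

variable {Cf Cu A τ' : ℝ} {F : ℝ → (EuclideanSpace ℝ (Fin 3)) → ℝ} {V : ℝ → (EuclideanSpace ℝ (Fin 3)) → (EuclideanSpace ℝ (Fin 3))}
  {B : ℝ → (EuclideanSpace ℝ (Fin 3)) → ℝ}

/-! ### The fourth estimate: the extra-drift term is `O(A C_f L / √(τ' − s))` -/

/-- The radial plateau `Ψ_L(y) = ψ_{L+1}(y/2) = ξ(r/2) η_{L+1}(y₂/2)`: smooth, axisymmetric, compactly supported, `0 ≤ Ψ ≤ 1`,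
`= 1` on the cylinder `{r ≤ 2, |z| ≤ L}` carrying `φ_{L,T}` (for `L ≥ 0`), supported in `{r ≤ 4}`, with radial derivative
`DΨ(y)[e_r y] = ½ ξ'(r/2) η_{L+1}(y₂/2)`, `|·| ≤ C_S/2`, vanishing for `r < 2`. -/
theorem plateau_props (L : ℝ) :
    ContDiff ℝ 1 (fun y : EuclideanSpace ℝ (Fin 3) => psiCut (L + 1) ((2 : ℝ)⁻¹ • y)) ∧
    HasCompactSupport (fun y : EuclideanSpace ℝ (Fin 3) => psiCut (L + 1) ((2 : ℝ)⁻¹ • y)) ∧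
    IsAxisymmetricScalar (fun y : EuclideanSpace ℝ (Fin 3) => psiCut (L + 1) ((2 : ℝ)⁻¹ • y)) ∧
    (∀ y, fderiv ℝ (fun y : EuclideanSpace ℝ (Fin 3) => psiCut (L + 1) ((2 : ℝ)⁻¹ • y)) y (eR y) =
      2⁻¹ * (deriv xiCut (cylRadius ((2 : ℝ)⁻¹ • y)) * Calculus.cutoff (L + 1) (((2 : ℝ)⁻¹ • y) 2))) := by
  set Ψ : EuclideanSpace ℝ (Fin 3) → ℝ := fun y => psiCut (L + 1) ((2 : ℝ)⁻¹ • y) with hΨ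
  have hlin : ContDiff ℝ 1 fun y : EuclideanSpace ℝ (Fin 3) => (2 : ℝ)⁻¹ • y := contDiff_const_smul _
  have h1 : ContDiff ℝ 1 Ψ := (contDiff_psiCut (L + 1) (n := 1)).comp hlin
  refine ⟨h1, ?_, ?_, ?_⟩
  · have e : Ψ = psiCut (L + 1) ∘ (Homeomorph.smulOfNeZero (2 : ℝ)⁻¹ (by norm_num) :
        EuclideanSpace ℝ (Fin 3) ≃ₜ EuclideanSpace ℝ (Fin 3)) := by
      funext y; rfl
    rw [e]
    exact (hasCompactSupport_psiCut (L + 1)).comp_homeomorph _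
  · intro θ y
    show psiCut (L + 1) ((2 : ℝ)⁻¹ • rotZ θ y) = psiCut (L + 1) ((2 : ℝ)⁻¹ • y)
    have e : (2 : ℝ)⁻¹ • rotZ θ y = rotZ θ ((2 : ℝ)⁻¹ • y) := by
      rw [← rotZL_apply, ← rotZL_apply, map_smul]
    rw [e]
    exact isAxisymmetricScalar_psiCut (L + 1) θ _
  · intro y
    set Lc : EuclideanSpace ℝ (Fin 3) →L[ℝ] EuclideanSpace ℝ (Fin 3) :=
      (2 : ℝ)⁻¹ • ContinuousLinearMap.id ℝ (EuclideanSpace ℝ (Fin 3)) with hLcdef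
    have hLc : ∀ w : EuclideanSpace ℝ (Fin 3), Lc w = (2 : ℝ)⁻¹ • w := fun w => by simp [hLcdef]
    have hfun : (fun y : EuclideanSpace ℝ (Fin 3) => psiCut (L + 1) ((2 : ℝ)⁻¹ • y)) = psiCut (L + 1) ∘ Lc := by
      funext w; simp [hLc]
    have hd : DifferentiableAt ℝ (psiCut (L + 1)) (Lc y) :=
      (contDiff_psiCut (L + 1) (n := 1)).differentiable one_ne_zero _
    have hc := hd.hasFDerivAt.comp y Lc.hasFDerivAt
    rw [hΨ, hfun, hc.fderiv, ContinuousLinearMap.comp_apply, hLc (eR y), map_smul, smul_eq_mul, hLc y]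
    have he : eR y = eR ((2 : ℝ)⁻¹ • y) := by
      have := eR_smul_eZ_add_smul 0 (by norm_num : (0 : ℝ) < 2⁻¹) y
      rw [zero_smul, zero_add] at this
      exact this.symm
    rw [he, fderiv_psiCut_apply_eR]

/-- Pointwise facts about the plateau: `0 ≤ Ψ ≤ 1`; `Ψ = 1` on `{r ≤ 2, |z| ≤ L}`; `Ψ(y) ≠ 0 ⇒ r(y) < 4`;
`|DΨ(y)[e_r y]| ≤ C_S/2` and `= 0` if `r(y) < 2`. -/
theorem plateau_pointwise (L : ℝ) (y : EuclideanSpace ℝ (Fin 3)) :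
    0 ≤ psiCut (L + 1) ((2 : ℝ)⁻¹ • y) ∧ psiCut (L + 1) ((2 : ℝ)⁻¹ • y) ≤ 1 ∧
    (y ∈ solidCylinder 2 L → psiCut (L + 1) ((2 : ℝ)⁻¹ • y) = 1) ∧
    (psiCut (L + 1) ((2 : ℝ)⁻¹ • y) ≠ 0 → cylRadius y < 4) ∧
    |2⁻¹ * (deriv xiCut (cylRadius ((2 : ℝ)⁻¹ • y)) * Calculus.cutoff (L + 1) (((2 : ℝ)⁻¹ • y) 2))| ≤
      smoothTransitionC2Bound / 2 ∧
    (cylRadius y < 2 →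
      2⁻¹ * (deriv xiCut (cylRadius ((2 : ℝ)⁻¹ • y)) * Calculus.cutoff (L + 1) (((2 : ℝ)⁻¹ • y) 2)) = 0) := by
  have hr : cylRadius ((2 : ℝ)⁻¹ • y) = 2⁻¹ * cylRadius y := by
    rw [cylRadius_smul, abs_of_pos (by norm_num)]
  have hz : ((2 : ℝ)⁻¹ • y) 2 = 2⁻¹ * y 2 := by simp
  obtain ⟨ψ0, ψ1⟩ := psiCut_mem_Icc (L + 1) ((2 : ℝ)⁻¹ • y)
  refine ⟨ψ0, ψ1, ?_, ?_, ?_, ?_⟩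
  · rintro ⟨h2, hL⟩
    rw [psiCut, hr, hz, xiCut_of_le_one (by linarith), Calculus.cutoff_eq_one, one_mul]
    rw [abs_mul, abs_of_pos (by norm_num : (0:ℝ) < 2⁻¹)]
    linarith [abs_nonneg (y 2)]
  · intro hne
    by_contra h4
    apply hne
    rw [psiCut, hr, xiCut_of_two_le (by linarith), zero_mul]
  · rw [abs_mul, abs_of_pos (by norm_num : (0:ℝ) < 2⁻¹), abs_mul]
    have h1 := abs_deriv_xiCut_le (cylRadius ((2 : ℝ)⁻¹ • y))
    have h2 : |Calculus.cutoff (L + 1) (((2 : ℝ)⁻¹ • y) 2)| ≤ 1 := by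
      rw [abs_of_nonneg (Calculus.cutoff_nonneg _ _)]; exact Calculus.cutoff_le_one _ _
    have := mul_le_mul h1 h2 (abs_nonneg _) smoothTransitionC2Bound_nonneg
    linarith
  · intro h2
    rw [hr, deriv_xiCut_of_lt_one (by linarith), zero_mul, mul_zero]

/-- **Estimate of the extra-drift term** (the one new estimate of the sourced argument): for `s ∈ (0, T]`, `T < τ'`,
`|∫ B ∂ᵣF φ dy| ≤ (A / √(τ' − s)) · C_f C_S · |{r ≤ 4, |z| ≤ 2(L+1)}|`.  Proof: `|B| ≤ A/√(τ'−s)`, `∂ᵣF ≥ 0`, `0 ≤ φ ≤ Ψ_L`;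
on `supp Ψ_L ⊆ {r ≤ 4}` one has `∂ᵣF Ψ ≤ 2 (2/r) ∂ᵣF Ψ`; the axis integration by parts
(`integral_two_div_cylRadius_mul_fderiv_eR`, `F = 0` on the axis) gives `∫ (2/r) ∂ᵣF Ψ = −∫ (2/r) F ∂ᵣΨ`, and
`(2/r)|∂ᵣΨ| ≤ C_S/2` lives on `{2 ≤ r ≤ 4, |z| ≤ 2(L+1)}`. -/
theorem estimate_IV (hP : IsSourcedSwirl Cf Cu A τ' F V B) {L T : ℝ} (hTτ : T < τ')
    {s : ℝ} (hs : s ∈ Ioc 0 T) :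
    |∫ y, B s y * fderiv ℝ (F s) y (eR y) * phiCut L T s y| ≤
      A / Real.sqrt (τ' - s) * (Cf * smoothTransitionC2Bound * volume.real (solidCylinder 4 (2 * (L + 1)))) := by
  have hsτ : s < τ' := lt_of_le_of_lt hs.2 hTτ
  have hA := hP.A_nonneg
  have hCf := Cf_nonneg hP
  have hC := smoothTransitionC2Bound_nonneg
  have hsq : 0 < Real.sqrt (τ' - s) := Real.sqrt_pos.2 (by linarith)
  have hk : 0 ≤ A / Real.sqrt (τ' - s) := div_nonneg hA hsq.le
  set Ψ : EuclideanSpace ℝ (Fin 3) → ℝ := fun y => psiCut (L + 1) ((2 : ℝ)⁻¹ • y) with hΨ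
  set dΨ : EuclideanSpace ℝ (Fin 3) → ℝ := fun y =>
    2⁻¹ * (deriv xiCut (cylRadius ((2 : ℝ)⁻¹ • y)) * Calculus.cutoff (L + 1) (((2 : ℝ)⁻¹ • y) 2)) with hdΨ
  obtain ⟨hΨ1, hΨc, hΨa, hΨd⟩ := plateau_props L
  have hF1 : ContDiff ℝ 1 (F s) := (hP.smooth s hsτ).of_le (by norm_cast)
  have hcDF : Continuous (fderiv ℝ (F s)) := hF1.continuous_fderiv one_ne_zero
  have happly : Continuous fun q : ((EuclideanSpace ℝ (Fin 3)) →L[ℝ] ℝ) × (EuclideanSpace ℝ (Fin 3)) => q.1 q.2 :=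
    (isBoundedBilinearMap_apply (𝕜 := ℝ) (E := EuclideanSpace ℝ (Fin 3)) (F := ℝ)).continuous
  have hDm : Measurable fun y => fderiv ℝ (F s) y (eR y) :=
    happly.measurable.comp (hcDF.measurable.prodMk measurable_eR)
  -- the axis integration by parts against `Ψ`
  obtain ⟨hiL, hiR, hibp⟩ := integrable_and_integral_two_div_cylRadius_mul_fderiv_eR hF1 hΨ1 hΨc
    (hP.axisymmetric s hsτ) hΨa (hP.axis s hsτ)
  -- (1) `∫ |B ∂ᵣF φ| ≤ (A/√(τ'−s)) ∫ 2 (2/r) ∂ᵣF Ψ`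
  obtain ⟨hBD, -⟩ := integral_sourced_slice hP hsτ L T
  have hdom : Integrable fun y => A / Real.sqrt (τ' - s) * (2 * (2 / cylRadius y * (fderiv ℝ (F s) y (eR y) * Ψ y))) :=
    (hiL.const_mul 2).const_mul _
  have hle1 : ∀ y, |B s y * fderiv ℝ (F s) y (eR y) * phiCut L T s y| ≤
      A / Real.sqrt (τ' - s) * (2 * (2 / cylRadius y * (fderiv ℝ (F s) y (eR y) * Ψ y))) := by
    intro y
    obtain ⟨ψ0, ψ1, ψcyl, ψsupp, -, -⟩ := plateau_pointwise L y
    obtain ⟨φ0, φ1⟩ := phiCut_mem_Icc L T s y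
    have hD0 := hP.radial_nonneg s hsτ y
    have hbt := abs_beta_mul_le_time hP hsτ y
    -- `φ ≤ Ψ`
    have hφΨ : phiCut L T s y ≤ Ψ y := by
      by_cases hy : y ∈ solidCylinder 2 L
      · rw [show Ψ y = 1 from ψcyl hy]; exact φ1
      · rw [(phiCut_derivs_eq_zero_of_not_mem (T := T) (s := s) hy).1]; exact ψ0
    -- `∂ᵣF Ψ ≤ 2 (2/r) ∂ᵣF Ψ` (support of `Ψ` in `r < 4`)
    have hw : fderiv ℝ (F s) y (eR y) * Ψ y ≤ 2 * (2 / cylRadius y * (fderiv ℝ (F s) y (eR y) * Ψ y)) := by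
      by_cases hΨ0 : Ψ y = 0
      · rw [hΨ0]; simp
      have hr4 := ψsupp hΨ0
      by_cases hr0 : cylRadius y = 0
      · have : fderiv ℝ (F s) y (eR y) = 0 := by simp [eR, hr0]
        rw [this]; simp
      have hr : 0 < cylRadius y := lt_of_le_of_ne (cylRadius_nonneg y) (Ne.symm hr0)
      have hge : 1 ≤ 2 * (2 / cylRadius y) := by
        rw [mul_div_assoc', le_div_iff₀ hr]; linarith
      have hP0 : 0 ≤ fderiv ℝ (F s) y (eR y) * Ψ y := mul_nonneg hD0 ψ0
      nlinarith
    rw [abs_mul, abs_of_nonneg φ0]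
    calc |B s y * fderiv ℝ (F s) y (eR y)| * phiCut L T s y
        ≤ (A / Real.sqrt (τ' - s) * fderiv ℝ (F s) y (eR y)) * Ψ y :=
          mul_le_mul hbt hφΨ φ0 (mul_nonneg hk hD0)
      _ = A / Real.sqrt (τ' - s) * (fderiv ℝ (F s) y (eR y) * Ψ y) := by ring
      _ ≤ A / Real.sqrt (τ' - s) * (2 * (2 / cylRadius y * (fderiv ℝ (F s) y (eR y) * Ψ y))) :=
          mul_le_mul_of_nonneg_left hw hk
  have step1 : |∫ y, B s y * fderiv ℝ (F s) y (eR y) * phiCut L T s y| ≤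
      A / Real.sqrt (τ' - s) * (2 * ∫ y, 2 / cylRadius y * (fderiv ℝ (F s) y (eR y) * Ψ y)) := by
    have h := norm_integral_le_of_norm_le hdom (Eventually.of_forall fun y => by
      rw [Real.norm_eq_abs]
      exact hle1 y)
    rw [Real.norm_eq_abs] at h
    refine h.trans (le_of_eq ?_)
    rw [integral_const_mul, integral_const_mul]
  -- (2) `∫ (2/r) ∂ᵣF Ψ = −∫ (2/r) F ∂ᵣΨ ≤ C_f ∫ (2/r)|∂ᵣΨ| ≤ C_f (C_S/2) |{r ≤ 4, |z| ≤ 2(L+1)}|`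
  have hind : Integrable ((solidCylinder 4 (2 * (L + 1))).indicator fun _ : EuclideanSpace ℝ (Fin 3) => (1 : ℝ)) :=
    (integrableOn_const (C := (1 : ℝ)) (volume_solidCylinder_lt_top 4 (2 * (L + 1))).ne).integrable_indicator
      (measurableSet_solidCylinder 4 (2 * (L + 1)))
  have hle2 : ∀ y, |2 / cylRadius y * (F s y * fderiv ℝ Ψ y (eR y))| ≤
      Cf * (smoothTransitionC2Bound / 2) * (solidCylinder 4 (2 * (L + 1))).indicator (fun _ => (1 : ℝ)) y := by
    intro y
    rw [hΨd y]
    obtain ⟨-, -, -, ψsupp, hdb, hd0⟩ := plateau_pointwise L y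
    by_cases hr2 : cylRadius y < 2
    · rw [hd0 hr2]; simp only [mul_zero, abs_zero]
      exact mul_nonneg (by positivity) (indicator_nonneg (fun _ _ => zero_le_one) _)
    have hr2' : 2 ≤ cylRadius y := le_of_not_gt hr2
    have hr : 0 < cylRadius y := by linarith
    have hw : 2 / cylRadius y ≤ 1 := by rw [div_le_iff₀ hr]; linarith
    have hF : |F s y| ≤ Cf := hP.abs_le s hsτ y
    by_cases hmem : y ∈ solidCylinder 4 (2 * (L + 1))
    · rw [indicator_of_mem hmem, mul_one, abs_mul, abs_mul, abs_of_nonneg (by positivity : (0:ℝ) ≤ 2 / cylRadius y)]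
      calc 2 / cylRadius y * (|F s y| * |2⁻¹ * (deriv xiCut (cylRadius ((2 : ℝ)⁻¹ • y)) *
            Calculus.cutoff (L + 1) (((2 : ℝ)⁻¹ • y) 2))|)
          ≤ 1 * (Cf * (smoothTransitionC2Bound / 2)) :=
            mul_le_mul hw (mul_le_mul hF hdb (abs_nonneg _) hCf) (by positivity) zero_le_one
        _ = Cf * (smoothTransitionC2Bound / 2) := one_mul _
    · -- off the big cylinder the derivative factor vanishes: either `r > 4` (then `ξ'(r/2) = 0`) or `|z| > 2(L+1)`
      rw [indicator_of_notMem hmem, mul_zero]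
      have hzero : 2⁻¹ * (deriv xiCut (cylRadius ((2 : ℝ)⁻¹ • y)) *
          Calculus.cutoff (L + 1) (((2 : ℝ)⁻¹ • y) 2)) = 0 := by
        have hr' : cylRadius ((2 : ℝ)⁻¹ • y) = 2⁻¹ * cylRadius y := by
          rw [cylRadius_smul, abs_of_pos (by norm_num)]
        have hz : ((2 : ℝ)⁻¹ • y) 2 = 2⁻¹ * y 2 := by simp
        simp only [solidCylinder, mem_setOf_eq, not_and_or, not_le] at hmem
        rcases hmem with h4 | hzL
        · rw [hr', deriv_xiCut_of_two_lt (by linarith), zero_mul, mul_zero]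
        · rw [hz, Calculus.cutoff_eq_zero, mul_zero, mul_zero]
          rw [abs_mul, abs_of_pos (by norm_num : (0:ℝ) < 2⁻¹)]
          linarith
      rw [hzero]; simp
  have step2 : ∫ y, 2 / cylRadius y * (fderiv ℝ (F s) y (eR y) * Ψ y) ≤
      Cf * (smoothTransitionC2Bound / 2) * volume.real (solidCylinder 4 (2 * (L + 1))) := by
    rw [hibp]
    have h := norm_integral_le_of_norm_le (hind.const_mul (Cf * (smoothTransitionC2Bound / 2)))
      (Eventually.of_forall fun y => by
        rw [Real.norm_eq_abs]
        exact hle2 y)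
    rw [Real.norm_eq_abs, integral_const_mul, integral_indicator (measurableSet_solidCylinder _ _),
      setIntegral_const, smul_eq_mul, mul_one] at h
    simp only [hΨ] at h ⊢
    linarith [neg_abs_le (∫ y, 2 / cylRadius y *
      (F s y * fderiv ℝ (fun y : EuclideanSpace ℝ (Fin 3) => psiCut (L + 1) ((2 : ℝ)⁻¹ • y)) y (eR y)))]
  calc |∫ y, B s y * fderiv ℝ (F s) y (eR y) * phiCut L T s y|
      ≤ A / Real.sqrt (τ' - s) * (2 * ∫ y, 2 / cylRadius y * (fderiv ℝ (F s) y (eR y) * Ψ y)) := step1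
    _ ≤ A / Real.sqrt (τ' - s) * (2 * (Cf * (smoothTransitionC2Bound / 2) *
        volume.real (solidCylinder 4 (2 * (L + 1))))) := by gcongr
    _ = A / Real.sqrt (τ' - s) * (Cf * smoothTransitionC2Bound * volume.real (solidCylinder 4 (2 * (L + 1)))) := by
        ring

end IsSourcedSwirl

end Summit.NavierStokesRegularity.NavierStokesRegularity.Theorems.HalfSpaceWindowDoorCirculationCarryingRigiditySourcedSwirlSourceEstimate

end
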